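import Mathlib
import HarnessLib
import Summits.QuantumFields.YangMills.Theses.ScalingWindowSplit
import Summits.QuantumFields.YangMills.Theorems.ScalingWindowSplitExistenceLegFromLattice

/-!
# Route `ScalingWindowSplit`, support item `ExistenceLegFromLatticeR` (stmt-QuantumFields-18015)

THE TYPED SPLIT of the route, re-pointed at the REPAIRED ultraviolet item (rev 6): the three lattice items
`GapAtCorrelationLength` (W₁, IR, renormalisation-free, `∃` over `(r, sch, u, p, M, Δ, C)` with a PAST-SUPPORTED bump `u`),
`SelfNormalisedSkewness` (W₂, `κ₃` floor of the self-normalised field) and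
`SelfNormalisedMomentBoundsR` (U_R, `k`-uniform plane-resolved `n!`-moment bounds of the self-normalised field, now
carrying W₂'s past-support clause `tsupport u ⊆ {y | y 0 < 0}`)
imply the shared existence leg `CoincidenceRotationBootstrap.HypercubicLimit` (stmt-QuantumFields-16154) BY NAME.

Proof: literally the landed `existenceLegFromLattice_proof`
(`Theorems/ScalingWindowSplitExistenceLegFromLattice.lean`) with ONE more token — the past-support hypothesis `hu`
of W₁'s witness is now also fed to U_R.  Fix a compact simple `G`; W₁ gives `(r, sch, u, p, M, Δ, C)`; U_R and W₂ at
that witness give the self-normalised moment bounds and the `κ₃` floor; the landed seam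
`oneField_of_latticeInequalities` gives a weak-coupling scheme with the one-field clauses, and ONE FIELD SUFFICES
(`hypercubicLimit_iff_oneFieldWeak`).

References: Glimm–Jaffe, *Quantum Physics* (1987) §6.1, §19.1 (truncated functions, renormalisation);
Osterwalder–Seiler, Ann. Phys. 110 (1978) §2.  No definitions, no notation, no named facts.
-/

noncomputable section

open scoped SchwartzMap BigOperators Topology Classical MeasureTheory ProbabilityTheory Matrix
open MeasureTheory ProbabilityTheory Filter Topology
open Literature.MathematicalPhysics.AQFT Literature.MathematicalPhysics.QuantumLattice
open Literature.MathematicalPhysics.QuantumFieldTheory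

namespace Summit.QuantumFields.YangMills.Theorems.ScalingWindowSplit

/-- **Support item `ExistenceLegFromLatticeR`** of route `ScalingWindowSplit` (stmt-QuantumFields-18015), THE TYPED
SPLIT re-pointed at the repaired U: `GapAtCorrelationLength → SelfNormalisedSkewness → SelfNormalisedMomentBoundsR →
CoincidenceRotationBootstrap.HypercubicLimit`.  Fix a compact simple `G`; W₁ gives `(r, sch, u, p, M, Δ, C)` with `u`
past-supported; U_R and W₂ at that witness (both now read the past-support clause `hu`) give the self-normalised moment
bounds and the `κ₃` floor; the seam (`oneField_of_latticeInequalities`) gives a weak-coupling scheme with the one-field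
clauses, and ONE FIELD SUFFICES (`hypercubicLimit_iff_oneFieldWeak`). [cite: GlimmJaffe1987, §6.1 and §19.1] -/
theorem existenceLegFromLatticeR_proof :
    Summit.QuantumFields.YangMills.Theses.ScalingWindowSplit.ExistenceLegFromLatticeR := by
  unfold Summit.QuantumFields.YangMills.Theses.ScalingWindowSplit.ExistenceLegFromLatticeR
  intro hW hS hU
  refine Summit.QuantumFields.YangMills.Theorems.HypercubicLimit.OneFieldWeak.hypercubicLimit_iff_oneFieldWeak.mpr
    fun G _ _ _ _ hG => ?_
  letI : MeasurableSpace G := borel G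
  haveI : BorelSpace G := ⟨rfl⟩
  obtain ⟨r, sch, u, p, M, Δ, C, hw, hpv, hΔ, hgap, hrp, hu, hfw⟩ := hW G hG
  obtain ⟨sch', S₁, hw', h₁⟩ := oneField_of_latticeInequalities r sch u p M Δ C hw hpv hΔ hgap hrp hu hfw
    (hU G r sch u p M hw hpv hu hfw) (hS G r sch u p M hw hpv hu hfw)
  exact ⟨r, sch', S₁, hw', h₁⟩

/-- The repaired split implies the rev-0 split through the unrepaired U: `SelfNormalisedMomentBounds` (no
past-support clause) trivially implies `SelfNormalisedMomentBoundsR` (one more hypothesis, ignored), so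
`ExistenceLegFromLatticeR → ExistenceLegFromLattice`. [folklore] -/
theorem existenceLegFromLattice_of_R
    (hLeg : Summit.QuantumFields.YangMills.Theses.ScalingWindowSplit.ExistenceLegFromLatticeR) :
    Summit.QuantumFields.YangMills.Theses.ScalingWindowSplit.ExistenceLegFromLattice := by
  unfold Summit.QuantumFields.YangMills.Theses.ScalingWindowSplit.ExistenceLegFromLattice
  intro hW hS hU
  refine hLeg hW hS ?_
  intro G _ _ _ _ _ _ r sch u p M bare T canon hw hpv _hu hfw
  exact hU G r sch u p M hw hpv hfw

end Summit.QuantumFields.YangMills.Theorems.ScalingWindowSplit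

end
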